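import Summits.ResolutionOfSingularities.ResolutionOfSingularities.Theorems.HilbertSamuelEliminationSigmaMaxModificationsCorridor3SigmaBirthAges
import Literature.AlgebraicGeometry.Resolution.QuasiExcellentSchemes
import HarnessLib

/-!
# [OURS · L1 W4.2] σ-LAYER (Live / NC) — `Corridor3SigmaBirthEvents`: FINITELY MANY OBJECTS ARE FOUNDED PER STEP
# (the (NC-c) branching bound of the object forest: lineages born and full corners born along one boundary-threaded σ-step)

Additive sibling of `…Corridor3SigmaBirthDictionary3` / `…SigmaBirthAges` (res-type-067 g12; res-L1-w42-plan-1 RULINGS v3.14-26 (GL)/(GN), -27 (GR),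
CHAIN v3.19 §0r.3 (NC) «067 fibre-finiteness»). OURS (cell res-hironaka, slot W4.2); NOT statements of H. Hironaka's manuscript [Hironaka2017] nor of
[CossartJannsenSaito2020]; AI-typed, weaker than expert review. Proof-only helper module, `--supports stmt-ResolutionOfSingularities-19249 --as helper`
(counted 0); NO row is claimed. Fact-free.

## What (NC-c) needs and what is true

The object forest of the (Live) dichotomy has nodes = group corners ∪ stratum lineages (∪ partial-frame sites) and needs FINITE BRANCHING: every
event (one blow-up step) founds finitely many new objects. This file supplies the two counts in the σ-layer's own currency:
* LINEAGES: the irreducible components of the new `ν`-stratum `X'(ν)` — indeed of ANY subset of a reached stage — are finitely many, because every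
  stage reached from a maximal origin is a NOETHERIAN scheme (finite type over the origin's field; blow-ups are proper). This is the count for births
  after POINT, CURVE and SURFACE centres alike (§1–§2).
* CORNERS: on the new exceptional member the full corners are exactly the fixed points over the centre (`isFullCorner_next_iff`), finitely many under
  the pair clause (`fixedPointsOver_finite`); group corners are full corners, so a fortiori (§3).
The planner's localisation «founded objects lie over finitely many CLOSED POINTS of the centre» holds for point centres (trivially) and for curve
centres (a non-dominating founded component lies over one closed point — not typed here), but NOT as phrased for a SURFACE centre `D`: the blow-up is
finite over `D`, so a non-dominating founded component is a curve over a CURVE of `D` or a point (toric check: `h = y^m + u_a^m(…)`, the triple line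
over `D_a ∩ D_b`); the forest should therefore charge surface-step events to the finitely many founded COMPONENTS (§2), which is all Kőnig needs.
-/

noncomputable section

set_option linter.dupNamespace false

open CategoryTheory AlgebraicGeometry TopologicalSpace
open Summit.ResolutionOfSingularities.ResolutionOfSingularities.Theorems.CampaignW42
open Literature.AlgebraicGeometry.Resolution Literature.RingTheory.HilbertSamuel

namespace Summit.ResolutionOfSingularities.ResolutionOfSingularities.Theorems.SigmaMaxModificationsCorridor3.Sigma

universe u

/-! ## §1. Finite type over a field, hence Noetherianity, along boundary-threaded σ-runs -/

/-- Finite type over a field propagates along a boundary-threaded σ-step (blow-ups are proper; copy of res-type-040's blind-strategy lemma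
`exists_overField_of_canonicalNearStepσ` for `CanonicalNearStepσE`). [cite: GortzWedhorn2020, Prop. 13.96 (1)] -/
theorem exists_overField_of_canonicalNearStepσE {σ : StrategyE.{u}} {N : ℕ} {ν : ℕ → ℕ} {k : Type u} [Field k] {s s' : MarkedStageE.{u}}
    (h : ∃ f : s.W ⟶ Spec (.of k), LocallyOfFiniteType f ∧ QuasiCompact f) (hst : CanonicalNearStepσE σ N ν s s') :
    ∃ f : s'.W ⟶ Spec (.of k), LocallyOfFiniteType f ∧ QuasiCompact f := by
  obtain ⟨C, P', hln, x', -, -, -, -, rfl⟩ := hst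
  obtain ⟨f, hf, hq⟩ := h
  haveI := s.ln
  haveI : IsProper (blowup.π C) := (blowup.isBlowup C).isProper
  exact ⟨blowup.π C ≫ f, inferInstance, inferInstance⟩

/-- … and along `ReachesσE`. [folklore] -/
theorem exists_overField_of_reachesσE {σ : StrategyE.{u}} {N : ℕ} {ν : ℕ → ℕ} {k : Type u} [Field k] {s s' : MarkedStageE.{u}}
    (h : ∃ f : s.W ⟶ Spec (.of k), LocallyOfFiniteType f ∧ QuasiCompact f) (hr : ReachesσE σ N ν s s') :
    ∃ f : s'.W ⟶ Spec (.of k), LocallyOfFiniteType f ∧ QuasiCompact f := by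
  induction hr with
  | refl => exact h
  | tail _ hlast ih => exact exists_overField_of_canonicalNearStepσE ih hlast

/-- **Every stage σ-reached (boundary threaded) from a maximal origin is a NOETHERIAN scheme**, whatever the initial-boundary assignment.
[cite: GortzWedhorn2020, Prop. 13.96 (1)] -/
theorem InScopeMσE.isNoetherian {p : ℕ} {σ : StrategyE.{u}} {N : ℕ} {ν : ℕ → ℕ} {E₀ : ∀ (X : Scheme.{u}), X → Boundary X}
    {s : MarkedStageE.{u}} (h : InScopeMσE p σ N ν E₀ s) : IsNoetherian s.W := by
  obtain ⟨X, hX, x, horig, hreach⟩ := h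
  obtain ⟨k, _, _, f, -, hft, hqc⟩ := horig.exists_structure
  obtain ⟨g, hg, hq⟩ := exists_overField_of_reachesσE (k := k) (s := ⟨@MarkedStage.init X hX x, E₀ X x⟩) ⟨f, hft, hqc⟩ hreach
  exact Scheme.isNoetherian_of_finiteType_over_field g

/-! ## §2. (NC-c), lineages: finitely many stratum components at every reached stage -/

/-- **FINITELY MANY IRREDUCIBLE COMPONENTS** of any subset (in particular of the `ν`-stratum `X(ν)`, of the part of `X(ν)` over a centre, of an E-stratum)
at every stage in scope — the number of lineages an event can found is finite. [folklore] -/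
theorem InScopeMσE.componentsIn_finite {p : ℕ} {σ : StrategyE.{u}} {N : ℕ} {ν : ℕ → ℕ} {E₀ : ∀ (X : Scheme.{u}), X → Boundary X}
    {s : MarkedStageE.{u}} (h : InScopeMσE p σ N ν E₀ s) (S : Set s.W) : (componentsIn S).Finite := by
  haveI : IsNoetherian s.W := h.isNoetherian
  exact componentsIn.finite S

/-- In particular: finitely many components of the `ν`-stratum at every stage in scope. [folklore] -/
theorem InScopeMσE.componentsIn_hsStratum_finite {p : ℕ} {σ : StrategyE.{u}} {N : ℕ} {ν : ℕ → ℕ} {E₀ : ∀ (X : Scheme.{u}), X → Boundary X}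
    {s : MarkedStageE.{u}} (h : InScopeMσE p σ N ν E₀ s) : (componentsIn (Scheme.hsStratum s.W N ν)).Finite :=
  h.componentsIn_finite _

/-- … and the intrinsic menus stay finite along the run (the menu file's hypothesis `NoetherianSpace` discharged on the scope). [folklore] -/
theorem InScopeMσE.intrinsicMenuPlusAt_finite {p : ℕ} {σ : StrategyE.{u}} {N : ℕ} {ν : ℕ → ℕ} {E₀ : ∀ (X : Scheme.{u}), X → Boundary X}
    {s : MarkedStageE.{u}} (h : InScopeMσE p σ N ν E₀ s) (x : s.W) : (IntrinsicMenuPlusAt s.E N ν x).Finite := by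
  haveI : IsNoetherian s.W := h.isNoetherian
  exact Sigma.intrinsicMenuPlusAt_finite s.E N ν x

/-! ## §3. (NC-c), corners: finitely many full corners are born per step (under the pair clause) -/

variable {W : Scheme.{u}}

/-- **THE FULL CORNERS BORN ON THE NEW EXCEPTIONAL MEMBER ARE FINITELY MANY** under the pair clause (they are the fixed points over the centre).
Group corners (W-top, cone frame) are full corners, so a fortiori. [folklore] -/
theorem newbornFullCorners_finite {E : Boundary W} {C : W.IdealSheafData} (hP : E.PairsMeetNewFinite C) :
    {x' : ↥(blowup C) | x' ∈ ((C.comap (blowup.π C)).support : Set ↥(blowup C)) ∧ IsFullCorner (E.next C) x'}.Finite := by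
  refine (fixedPointsOver_finite hP).subset ?_
  rintro x' ⟨hF, hfull⟩
  exact ⟨hF, (isFullCorner_next_iff hF).mp hfull⟩

/-- **Along a σ-step**: under the pair clause at the state stepped from, the full corners of the new stage lying on its newest member are finitely many.
[folklore] -/
theorem CanonicalNearStepσE.newbornFullCorners_finite {σ : StrategyE.{u}} {N : ℕ} {ν : ℕ → ℕ}
    {𝒮 : ∀ (W : Scheme.{u}), IsLocallyNoetherian W → Labelling W → Option (Pending W) → Boundary W → Prop}
    (hσ : σ.RespectsPairClauseOn 𝒮 N ν) {s s' : MarkedStageE.{u}} (h : CanonicalNearStepσE σ N ν s s')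
    (hs : 𝒮 s.W s.ln s.L s.P s.E) : {x' : s'.W | IsOnNewest s'.E x' ∧ IsFullCorner s'.E x'}.Finite := by
  obtain ⟨C, P', hln, x', hstep, -, -, -, rfl⟩ := h
  have hP : s.E.PairsMeetNewFinite C := hσ s.W s.ln s.L s.P s.E hs C P' hstep
  refine (Sigma.newbornFullCorners_finite hP).subset ?_
  rintro y ⟨hy, hfull⟩
  exact ⟨isOnNewest_next_iff.mp hy, hfull⟩

/-- **Along a σ-step, all full corners of the new stage** (newborn + the children over old full corners) are finitely many under the pair clause and the
triple binder of the old boundary — the run-level form is `InScopeMσE.fullCornerLocus_finite` (`…SigmaMenuCorners` §4). [folklore] -/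
theorem CanonicalNearStepσE.fullCornerLocus_finite {σ : StrategyE.{u}} {N : ℕ} {ν : ℕ → ℕ}
    {𝒮 : ∀ (W : Scheme.{u}), IsLocallyNoetherian W → Labelling W → Option (Pending W) → Boundary W → Prop}
    (hσ : σ.RespectsPairClauseOn 𝒮 N ν) {s s' : MarkedStageE.{u}} (h : CanonicalNearStepσE σ N ν s s')
    (hs : 𝒮 s.W s.ln s.L s.P s.E) (hE : s.E.TripleMeetsFinite) : (fullCornerLocus s'.E N ν).Finite :=
  Sigma.fullCornerLocus_finite (h.tripleMeetsFinite hσ hs hE) N ν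

end Summit.ResolutionOfSingularities.ResolutionOfSingularities.Theorems.SigmaMaxModificationsCorridor3.Sigma

end
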